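import Mathlib.Analysis.SpecialFunctions.ExpDeriv
import Literature.Analysis.ODE.OneSidedComparison
import HarnessLib

/-!
# Fluid computer blueprint — drain conversion: the OVERDAMPED band

HONEST FRAMING: low prior, high value-of-information experiment on Tao's machine paradigm; NOT a
claim that NS blows up. Elementary planar ODE estimates; nothing is asserted about any fluid
equation or about the threshold gate itself.

## Why

The drain conversion of the threshold gate runs through a damping band `γ₀ω ≤ g ≤ γ₁ω` whose
CEILING `γ₁` is large at the end of the transfer (the output `ã` has absorbed most of the energy,
so `g = κã` is big while the rotor speed `ω = rc` is not): the OVERDAMPED regime. There the two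
landed decay constants are poor — `γ₀/(3(1 + γ₁²))` (`DrainConversionTime.energy_decay_time`)
decays like `γ₁⁻²`, and the sharp `γ₀ - γ₀²(γ₁ - γ₀)/(8(1 - γ₀/2))`
(`DrainConversionSharp.energy_decay_time_sharp`) needs `γ₀ < 2` and turns negative once
`γ₁ - γ₀ ≳ 8/γ₀²`. The truth for constant damping `γ ≫ 1` is the slow rate `≈ 1/γ` (in angle).
This file proves a band-uniform version within a factor `4` of it: with `β := 2/γ₁` (any
`0 < β ≤ 1` with `βω ≤ g` and `βg ≤ 2ω` on the window) the Lyapunov function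
`V = a² + d² - β·ad` satisfies `V' ≤ -(β/4)·ω·V + 8Rδ`, whence

* `DampedRotor.energy_decay_time_overdamped` — for `0 ≤ λ ≤ β/4`,
  `(1 - β/2)(a(t)² + d(t)²) ≤ exp(-λΘ(t))·((1 + β/2)(a(0)² + d(0)²) + 8Rδ·exp(λΘM)·t)`,
  same shape as the sharp lemma (so it plugs into `ThresholdDrainWindow` verbatim), rate `1/(2γ₁)`
  per radian on the band `[2/γ₁, γ₁]` (`γ₁ ≥ 2`);
* `DampedRotor.lyapunov_alg_overdamped` — the pointwise algebra: with `e = g - βω ≥ 0`,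
  `V' + (β/4)ωV = (3βω/4)(-a² - d² + β·ad) + e(-2d² + β·ad) ≤ -(3βω/8)(a² + d²) + (βe)·βa²/8`
  and `βe ≤ 2ω`.

Calibration (toy model `SelfDampingRotor`, band `[1, k√E]` after build-up): the conversion angle
`3(1 + k²E)·log 15` of `IsTrajectory.conversion` would become `2k√E·log(…)` for `k√E ≥ 2`.
[cite: Tao2016AveragedNS, §5.5 (the energy-transfer phase of Thm 5.3)]
-/

noncomputable section

open Set Real

namespace Literature.Analysis.FluidPDE.FluidComputer

open Literature.Analysis.ODE

namespace DampedRotor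

/-- The overdamped algebraic step: for `0 ≤ β ≤ 1`, `ω ≥ 0`, `βω ≤ g` and `βg ≤ 2ω`,
`-2g·d² + βω·d² - βω·a² + βg·(ad) ≤ -(β/4)·ω·(a² + d² - β·ad)`. [folklore] -/
theorem lyapunov_alg_overdamped {β ω g a d : ℝ} (hβ0 : 0 ≤ β) (hβ1 : β ≤ 1) (hω : 0 ≤ ω)
    (hg : β * ω ≤ g) (hg₁ : β * g ≤ 2 * ω) :
    -2 * g * d ^ 2 + β * ω * d ^ 2 - β * ω * a ^ 2 + β * g * (a * d) ≤
      -(β / 4 * ω * (a ^ 2 + d ^ 2 - β * (a * d))) := by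
  have he : 0 ≤ g - β * ω := by linarith
  have hβ2ω : 0 ≤ β ^ 2 * ω := by positivity
  have heβ : β * (g - β * ω) ≤ 2 * ω := by nlinarith [hg₁, hβ2ω]
  have hid : -2 * g * d ^ 2 + β * ω * d ^ 2 - β * ω * a ^ 2 + β * g * (a * d) +
      β / 4 * ω * (a ^ 2 + d ^ 2 - β * (a * d)) =
      3 * β * ω / 4 * (-a ^ 2 - d ^ 2 + β * (a * d)) +
        (g - β * ω) * (-2 * d ^ 2 + β * (a * d)) := by
    ring
  have had : 2 * (a * d) ≤ a ^ 2 + d ^ 2 := by nlinarith [sq_nonneg (a - d)]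
  have h1a : β * (a * d) ≤ β * ((a ^ 2 + d ^ 2) / 2) :=
    mul_le_mul_of_nonneg_left (by linarith) hβ0
  have h1b : β * ((a ^ 2 + d ^ 2) / 2) ≤ (a ^ 2 + d ^ 2) / 2 := by
    have : 0 ≤ (1 - β) * ((a ^ 2 + d ^ 2) / 2) := mul_nonneg (by linarith) (by positivity)
    linarith
  have h1 : -a ^ 2 - d ^ 2 + β * (a * d) ≤ -((a ^ 2 + d ^ 2) / 2) := by linarith
  have h2 : -2 * d ^ 2 + β * (a * d) ≤ β ^ 2 * a ^ 2 / 8 := by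
    nlinarith [sq_nonneg (d - β * a / 4)]
  have h3 : 3 * β * ω / 4 * (-a ^ 2 - d ^ 2 + β * (a * d)) ≤
      3 * β * ω / 4 * (-((a ^ 2 + d ^ 2) / 2)) := mul_le_mul_of_nonneg_left h1 (by positivity)
  have h4 : (g - β * ω) * (-2 * d ^ 2 + β * (a * d)) ≤ (g - β * ω) * (β ^ 2 * a ^ 2 / 8) :=
    mul_le_mul_of_nonneg_left h2 he
  have h5 : β * (g - β * ω) * (β * a ^ 2 / 8) ≤ 2 * ω * (β * a ^ 2 / 8) :=
    mul_le_mul_of_nonneg_right heβ (by positivity)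
  have h6 : 0 ≤ β * ω * a ^ 2 := by positivity
  have h7 : 0 ≤ β * ω * d ^ 2 := by positivity
  nlinarith [hid, h3, h4, h5, h6, h7]

variable {a d a' d' ω g Θ : ℝ → ℝ} {β lam R δ ΘM T : ℝ}

/-- **Overdamped pair-energy decay in time, weighted by the angle.** See the module docstring:
for `0 < β ≤ 1`, `βω ≤ g`, `βg ≤ 2ω` and any `0 ≤ λ ≤ β/4`,
`(1 - β/2)(a(t)² + d(t)²) ≤ exp(-λΘ(t))·((1 + β/2)(a(0)² + d(0)²) + 8Rδ·exp(λΘM)·t)`.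
[folklore] -/
theorem energy_decay_time_overdamped (hac : ContinuousOn a (Icc 0 T))
    (hdc : ContinuousOn d (Icc 0 T))
    (ha' : ∀ s ∈ Ico 0 T, HasDerivWithinAt a (a' s) (Ici s) s)
    (hd' : ∀ s ∈ Ico 0 T, HasDerivWithinAt d (d' s) (Ici s) s)
    (hΘc : ContinuousOn Θ (Icc 0 T)) (hΘ0 : Θ 0 = 0)
    (hΘ' : ∀ s ∈ Ico 0 T, HasDerivWithinAt Θ (ω s) (Ici s) s) (hΘM : ∀ s ∈ Icc 0 T, Θ s ≤ ΘM)
    (hω : ∀ s ∈ Ico 0 T, 0 ≤ ω s) (hβ0 : 0 < β) (hβ1 : β ≤ 1)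
    (hlam0 : 0 ≤ lam) (hlam : lam ≤ β / 4)
    (hg : ∀ s ∈ Ico 0 T, β * ω s ≤ g s ∧ β * g s ≤ 2 * ω s) (hR : 0 ≤ R) (hδ : 0 ≤ δ)
    (hab : ∀ s ∈ Ico 0 T, |a s| ≤ R ∧ |d s| ≤ R)
    (hp : ∀ s ∈ Ico 0 T, |a' s + ω s * d s| ≤ δ)
    (hq : ∀ s ∈ Ico 0 T, |d' s - (ω s * a s - g s * d s)| ≤ δ) :
    ∀ t ∈ Icc 0 T, (1 - β / 2) * (a t ^ 2 + d t ^ 2) ≤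
      exp (-lam * Θ t) * ((1 + β / 2) * (a 0 ^ 2 + d 0 ^ 2) + 8 * R * δ * exp (lam * ΘM) * t) := by
  intro t ht
  have hm : 0 < 1 - β / 2 := by linarith
  have hRδ : 0 ≤ R * δ := mul_nonneg hR hδ
  -- Lyapunov function `V = a² + d² - β ad`
  set V : ℝ → ℝ := fun s => a s * a s + d s * d s - β * (a s * d s) with hV_def
  set V' : ℝ → ℝ := fun s => (a' s * a s + a s * a' s) + (d' s * d s + d s * d' s) -
    β * (a' s * d s + a s * d' s) with hV'_def
  have hVc : ContinuousOn V (Icc 0 T) :=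
    ((hac.mul hac).add (hdc.mul hdc)).sub (continuousOn_const.mul (hac.mul hdc))
  have hVd : ∀ s ∈ Ico 0 T, HasDerivWithinAt V (V' s) (Ici s) s := fun s hs =>
    (((ha' s hs).mul (ha' s hs)).add ((hd' s hs).mul (hd' s hs))).sub
      (((ha' s hs).mul (hd' s hs)).const_mul β)
  have hsand : ∀ s, (1 - β / 2) * (a s ^ 2 + d s ^ 2) ≤ V s ∧
      V s ≤ (1 + β / 2) * (a s ^ 2 + d s ^ 2) := by
    intro s
    have h1 : a s * d s ≤ (a s ^ 2 + d s ^ 2) / 2 := by nlinarith [sq_nonneg (a s - d s)]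
    have h2 : -(a s * d s) ≤ (a s ^ 2 + d s ^ 2) / 2 := by nlinarith [sq_nonneg (a s + d s)]
    have h3 := mul_le_mul_of_nonneg_left h1 hβ0.le
    have h4 := mul_le_mul_of_nonneg_left h2 hβ0.le
    have hV : V s = a s ^ 2 + d s ^ 2 - β * (a s * d s) := by simp only [hV_def]; ring
    constructor <;> linarith [hV, h3, h4]
  -- `V' + lam ω V ≤ 8Rδ`
  have hineq : ∀ s ∈ Ico 0 T, V' s + lam * ω s * V s ≤ 8 * R * δ := by
    intro s hs
    obtain ⟨hgs0, hgs1⟩ := hg s hs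
    obtain ⟨haR, hdR⟩ := hab s hs
    have hωs := hω s hs
    set p := a' s + ω s * d s with hp_def
    set q := d' s - (ω s * a s - g s * d s) with hq_def
    have hpδ : |p| ≤ δ := hp s hs
    have hqδ : |q| ≤ δ := hq s hs
    have ea : a' s = -(ω s * d s) + p := by simp only [hp_def]; ring
    have ed : d' s = ω s * a s - g s * d s + q := by simp only [hq_def]; ring
    have halg := lyapunov_alg_overdamped (a := a s) (d := d s) hβ0.le hβ1 hωs hgs0 hgs1
    have hf1 : a s * p ≤ R * δ := by
      have h := le_abs_self (a s * p); rw [abs_mul] at h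
      exact h.trans (mul_le_mul haR hpδ (abs_nonneg p) hR)
    have hf2 : d s * q ≤ R * δ := by
      have h := le_abs_self (d s * q); rw [abs_mul] at h
      exact h.trans (mul_le_mul hdR hqδ (abs_nonneg q) hR)
    have hf3 : -(p * d s) ≤ R * δ := by
      have h := neg_le_abs (p * d s); rw [abs_mul] at h
      have h2 : |p| * |d s| ≤ δ * R := mul_le_mul hpδ hdR (abs_nonneg _) hδ
      linarith
    have hf4 : -(a s * q) ≤ R * δ := by
      have h := neg_le_abs (a s * q); rw [abs_mul] at h
      exact h.trans (mul_le_mul haR hqδ (abs_nonneg q) hR)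
    have hf3' := mul_le_mul_of_nonneg_left hf3 hβ0.le
    have hf4' := mul_le_mul_of_nonneg_left hf4 hβ0.le
    have hγRδ : β * (R * δ) ≤ 2 * (R * δ) :=
      mul_le_mul_of_nonneg_right (by linarith : β ≤ 2) hRδ
    have hVs : V s = a s ^ 2 + d s ^ 2 - β * (a s * d s) := by simp only [hV_def]; ring
    have hlo := (hsand s).1
    have hV0 : 0 ≤ V s := le_trans (by positivity) hlo
    have hωV : 0 ≤ ω s * V s := mul_nonneg hωs hV0
    have hmono : -(β / 4 * (ω s * V s)) ≤ -(lam * (ω s * V s)) := by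
      have := mul_le_mul_of_nonneg_right hlam hωV
      linarith
    have hid : V' s + lam * ω s * V s =
        (-2 * g s * d s ^ 2 + β * ω s * d s ^ 2 - β * ω s * a s ^ 2 + β * g s * (a s * d s)) +
        (2 * (a s * p) + 2 * (d s * q) + β * (-(p * d s)) + β * (-(a s * q))) +
        lam * (ω s * V s) := by
      simp only [hV'_def, hVs, ea, ed]; ring
    rw [hid]
    have hmain : -2 * g s * d s ^ 2 + β * ω s * d s ^ 2 - β * ω s * a s ^ 2 +
        β * g s * (a s * d s) ≤ -(lam * (ω s * V s)) := by
      have h1 := halg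
      rw [← hVs] at h1
      have h1' : -2 * g s * d s ^ 2 + β * ω s * d s ^ 2 - β * ω s * a s ^ 2 +
          β * g s * (a s * d s) ≤ -(β / 4 * (ω s * V s)) := by
        have e : -(β / 4 * ω s * V s) = -(β / 4 * (ω s * V s)) := by ring
        rw [← e]; exact h1
      linarith [h1', hmono]
    linarith [hmain, hf1, hf2, hf3', hf4', hγRδ, hRδ]
  -- `W = exp(lam Θ) V` has `W' ≤ 8Rδ exp(lam ΘM)`
  have hE : ∀ s ∈ Ico 0 T, HasDerivWithinAt (fun x => exp (lam * Θ x))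
      (exp (lam * Θ s) * (lam * ω s)) (Ici s) s :=
    fun s hs => ((hΘ' s hs).const_mul lam).exp
  have hWc : ContinuousOn (fun s => exp (lam * Θ s) * V s) (Icc 0 T) :=
    ((continuousOn_const.mul hΘc).rexp).mul hVc
  have hWd : ∀ s ∈ Ico 0 T, HasDerivWithinAt (fun x => exp (lam * Θ x) * V x)
      (exp (lam * Θ s) * (lam * ω s) * V s + exp (lam * Θ s) * V' s) (Ici s) s :=
    fun s hs => (hE s hs).mul (hVd s hs)
  set M := 8 * R * δ * exp (lam * ΘM) with hM_def
  have hbd : ∀ s ∈ Ico 0 T,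
      exp (lam * Θ s) * (lam * ω s) * V s + exp (lam * Θ s) * V' s ≤ M := by
    intro s hs
    have hes : 0 < exp (lam * Θ s) := exp_pos _
    have h1 : exp (lam * Θ s) * (lam * ω s) * V s + exp (lam * Θ s) * V' s =
        exp (lam * Θ s) * (V' s + lam * ω s * V s) := by ring
    rw [h1]
    have h2 : exp (lam * Θ s) * (V' s + lam * ω s * V s) ≤ exp (lam * Θ s) * (8 * R * δ) :=
      mul_le_mul_of_nonneg_left (hineq s hs) hes.le
    have h3 : exp (lam * Θ s) ≤ exp (lam * ΘM) :=
      exp_le_exp.2 (mul_le_mul_of_nonneg_left (hΘM s (Ico_subset_Icc_self hs)) hlam0)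
    have h4 := mul_le_mul_of_nonneg_right h3 (by positivity : (0:ℝ) ≤ 8 * R * δ)
    simp only [hM_def]; linarith
  have hmain := sub_le_mul_of_deriv_right_le hWc hWd hbd t ht
  simp only [hΘ0, mul_zero, exp_zero, one_mul, sub_zero] at hmain
  -- unwind
  have het : 0 < exp (lam * Θ t) := exp_pos _
  have hexp_neg : exp (-lam * Θ t) = (exp (lam * Θ t))⁻¹ := by
    rw [← exp_neg]; congr 1; ring
  have hM0 : 0 ≤ M := by positivity
  have hVt : V t ≤ (exp (lam * Θ t))⁻¹ * (V 0 + M * t) := by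
    rw [le_inv_mul_iff₀ het]; linarith
  have hV0 := (hsand 0).2
  have hlo := (hsand t).1
  have hi0 : 0 ≤ (exp (lam * Θ t))⁻¹ := inv_nonneg.2 het.le
  have hm' := mul_le_mul_of_nonneg_left
    (by linarith [hV0] : V 0 + M * t ≤ (1 + β / 2) * (a 0 ^ 2 + d 0 ^ 2) + M * t) hi0
  rw [hexp_neg]
  simp only [hM_def] at hm' hVt
  linarith [hlo, hVt, hm']

end DampedRotor

end Literature.Analysis.FluidPDE.FluidComputer

end
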